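/-
Copyright (c) 2026 the pub-hodgecm-mathlib formalisation cell (harness21).  Prover seat hodgecm-mathlib-K2E3-p21 (g4), Track B «K2-LIT» ∕ h413
(`stmt-HodgeConjecture-24833`), line `K2_E3_EllipticInputs`, road «GL₂-sc» (road owner K2E5-p17 (g5); dealer D66), brick (2E-a2) = the `N = 2` twin of ★ (GL-6) part 1 `K2E3GL3SpectralIdempotentCentralizer`
(K2E3-p21 (g4)) «SPECTRAL IDEMPOTENT ⇒ UNBOUNDED CENTRALISER».  2026-09-04.
-/
import Summits.HodgeConjecture.HodgeConjecture.Theorems.K2E3NearTriangularEigenvalues   -- ★ FC-6a p857208 (K2E5-p01 g4): `v_inv_pow_uniformizer` (and the `Valued` frame)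
import Summits.HodgeConjecture.HodgeConjecture.Theorems.K2E3GL3SpectralIdempotentCentralizer   -- ★ (GL-6) part 1 p857518-era (K2E3-p21 (g4)): generic `exists_v_le_exp`, `exists_v_eq_exp` (reused)
import HarnessLib

/-!
# Crux `H413` — K2-LIT E3, road «FC-GL», brick (GL-6) part 1: a SIMPLE RATIONAL EIGENVALUE of `h ∈ 𝔤𝔩₂(K)` gives a non-trivial idempotent in the centraliser of
# `h`, and (over a valued field) a non-trivial idempotent in the centraliser makes the centraliser UNBOUNDED

Cell `hodgecm-mathlib`, Track B, line `K2_E3_EllipticInputs`, road «GL₂-sc» (Harish-Chandra's local integrability for supercuspidal `GL₂(F)`; BRICK LIST v1.1); the `N = 2` twin,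
statement for statement, of ★ (GL-6) part 1 (K2E3-p21 (g4)); part 2 `K2E3GL2HenselSplitCentralizer` supplies the simple rational root by strong Hensel and states the heads.  THEOREMS ONLY; count-neutral helper
(`--supports stmt-HodgeConjecture-24833 --as helper`); no `σ`, no measure.

* §1 (ANY FIELD) **SPECTRAL IDEMPOTENT OF A SIMPLE RATIONAL ROOT** `exists_idempotent_of_simple_root`: if `λ₀ ∈ K` is a root of `χ_h` with `χ_h′(λ₀) ≠ 0`, write
  `χ_h = (X − λ₀)·g`; then `e := g(λ₀)⁻¹·g(h)` satisfies `e² = e`, `h e = e h`, `e ≠ 0` (else `h − λ₀` would be invertible, but `det(λ₀ − h) = χ_h(λ₀) = 0`) and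
  `e = 1` only if `h = λ₀·1` (Cayley–Hamilton `(h − λ₀)·g(h) = 0`, and `g ≡ g(λ₀) mod (X − λ₀)`).
* §2 (VALUED FIELD, uniformizer `ϖ`) **IDEMPOTENT ⇒ UNBOUNDED CENTRALISER** `exists_centralizer_unbounded_of_idempotent`: for an idempotent `e ≠ 0, 1` commuting with
  `h ∈ GL₂(K)`, `y_n := ϖⁿ e + (1 − e) ∈ Z(h)` is invertible with `y_n⁻¹ = ϖ⁻ⁿ e + (1 − e)`, and for entries `e_{i′j′} ≠ 0`, `(1 − e)_{ij} ≠ 0` one has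
  `v((y_n)_{ij})·v((y_n⁻¹)_{i′j′}) = qⁿ·v(e_{i′j′})·v((1−e)_{ij})` for `n ≫ 0`, exceeding any `exp N`.

HONEST LABEL: HC_CM is proved only modulo the 7 printed citations (2 remaining named inputs: hLiu418 = stmt-HodgeConjecture-24832, h413 =
stmt-HodgeConjecture-24833) until rung 0 closes; elementary, closes no organ by itself.

## References
* [HarishChandra1970] Harish-Chandra (notes by G. van Dijk), *Harmonic Analysis on Reductive p-adic Groups*, LNM 162 (1970), Part VI §8 (an element with a
  rational eigenline has non-compact centraliser modulo the centre).
* [NeukirchANT1999] J. Neukirch, *Algebraic Number Theory* (1999), Ch. II §4 (valuations, uniformizers).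
-/

set_option autoImplicit false
-- the mandated namespace repeats `HodgeConjecture.HodgeConjecture`, as in every `Theorems/*.lean` of this sub-problem
set_option linter.dupNamespace false

noncomputable section

open Polynomial Matrix
open scoped WithZero ValuativeRel MatrixGroups
open Literature.NumberTheory.Automorphic
open Literature.NumberTheory.GaloisRepresentations Literature.NumberTheory.GaloisRepresentations.IsNonarchimedeanLocalField
open Summit.HodgeConjecture.HodgeConjecture.Cruxes.H413.K2E3NearTriangularEigenvalues

namespace Summit.HodgeConjecture.HodgeConjecture.Cruxes.H413.K2E3GL2SpectralIdempotentCentralizer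

open K2E3GL3SpectralIdempotentCentralizer (exists_v_le_exp exists_v_eq_exp)

/-! ## §1  The spectral idempotent of a simple rational root (any field) -/

section Algebra

variable {K : Type*} [Field K]

/-- **SPECTRAL IDEMPOTENT.**  If `λ₀ ∈ K` is a SIMPLE root of `χ_h` (`χ_h(λ₀) = 0`, `χ_h′(λ₀) ≠ 0`), there is an idempotent `e ≠ 0` commuting with `h`, and
`e = 1` only if `h = λ₀·1`: `e := g(λ₀)⁻¹·g(h)` for `χ_h = (X − λ₀) g` (Cayley–Hamilton). [folklore] -/
theorem exists_idempotent_of_simple_root (h : Matrix (Fin 2) (Fin 2) K) {l₀ : K} (hroot : h.charpoly.IsRoot l₀) (hsimple : h.charpoly.derivative.eval l₀ ≠ 0) :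
    ∃ e : Matrix (Fin 2) (Fin 2) K, e * e = e ∧ h * e = e * h ∧ e ≠ 0 ∧ (e = 1 → h = algebraMap K (Matrix (Fin 2) (Fin 2) K) l₀) := by
  set p := h.charpoly with hp
  set g := p /ₘ (X - C l₀) with hg
  have hpg : (X - C l₀) * g = p := (mul_divByMonic_eq_iff_isRoot).2 hroot
  -- `g(λ₀) = χ′(λ₀) ≠ 0`
  have hgl : g.eval l₀ = p.derivative.eval l₀ := by
    conv_rhs => rw [← hpg]
    simp only [derivative_mul, derivative_sub, derivative_X, derivative_C, sub_zero, one_mul, eval_add, eval_mul, eval_sub, eval_X, eval_C, sub_self,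
      zero_mul, add_zero]
  have hg0 : g.eval l₀ ≠ 0 := by rw [hgl]; exact hsimple
  -- `g = (X − λ₀) q + g(λ₀)`
  have hgq : (X - C l₀) * (g /ₘ (X - C l₀)) + C (g.eval l₀) = g := by
    have h1 := modByMonic_add_div g (X - C l₀)
    rw [modByMonic_X_sub_C_eq_C_eval, add_comm] at h1
    exact h1
  set G : Matrix (Fin 2) (Fin 2) K := aeval h g with hG
  have hCH : aeval h p = 0 := by rw [hp]; exact aeval_self_charpoly h
  have hkill : (h - algebraMap K _ l₀) * G = 0 := by
    have := congrArg (aeval h) hpg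
    rw [map_mul, hCH, map_sub, aeval_X, aeval_C] at this
    exact this
  have hkill' : G * (h - algebraMap K _ l₀) = 0 := by
    have := congrArg (aeval h) hpg
    rw [mul_comm, map_mul, hCH, map_sub, aeval_X, aeval_C] at this
    exact this
  have hGG : G * G = g.eval l₀ • G := by
    have := congrArg (aeval h) hgq
    rw [map_add, map_mul, map_sub, aeval_X, aeval_C, aeval_C, Algebra.algebraMap_eq_smul_one (g.eval l₀)] at this
    calc G * G = G * ((h - algebraMap K _ l₀) * aeval h (g /ₘ (X - C l₀)) + g.eval l₀ • 1) := by rw [this]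
      _ = g.eval l₀ • G := by rw [mul_add, ← mul_assoc, hkill', zero_mul, zero_add, mul_smul_comm, mul_one]
  have hGh : h * G = G * h := by
    have h1 : aeval h (X * g) = aeval h (g * X) := by rw [mul_comm]
    rwa [map_mul, map_mul, aeval_X] at h1
  refine ⟨(g.eval l₀)⁻¹ • G, ?_, ?_, ?_, ?_⟩
  · rw [smul_mul_smul_comm, hGG, smul_smul, inv_mul_cancel_right₀ hg0]
  · rw [mul_smul_comm, smul_mul_assoc, hGh]
  · -- `G = 0 ⇒ (h − λ₀)·q = −g(λ₀) ⇒ h − λ₀ invertible`, contradicting `det(λ₀ − h) = χ(λ₀) = 0`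
    intro h0
    have hG0 : G = 0 := by
      have := congrArg (fun A => g.eval l₀ • A) h0
      simpa only [smul_smul, mul_inv_cancel₀ hg0, one_smul, smul_zero] using this
    have hq : (h - algebraMap K _ l₀) * aeval h (g /ₘ (X - C l₀)) = -(g.eval l₀ • (1 : Matrix (Fin 2) (Fin 2) K)) := by
      have := congrArg (aeval h) hgq
      rw [map_add, map_mul, map_sub, aeval_X, aeval_C, aeval_C, Algebra.algebraMap_eq_smul_one (g.eval l₀), ← hG, hG0] at this
      exact eq_neg_of_add_eq_zero_left this
    have hdet : (h - algebraMap K _ l₀).det ≠ 0 := by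
      intro hd
      have := congrArg Matrix.det hq
      rw [det_mul, hd, zero_mul, det_neg, det_smul, det_one, mul_one, Fintype.card_fin] at this
      exact pow_ne_zero 2 hg0 (by
        have h3 : ((-1 : K) ^ 2 * g.eval l₀ ^ 2) = 0 := this.symm
        simpa using h3)
    apply hdet
    have hev : p.eval l₀ = (Matrix.scalar (Fin 2) l₀ - h).det := by rw [hp]; exact eval_charpoly h l₀
    rw [hroot.eq_zero] at hev
    have : h - algebraMap K _ l₀ = -(Matrix.scalar (Fin 2) l₀ - h) := by rw [neg_sub]; rfl
    rw [this, det_neg, ← hev, mul_zero]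
  · intro h1
    have hG1 : G = g.eval l₀ • (1 : Matrix (Fin 2) (Fin 2) K) := by
      have := congrArg (fun A => g.eval l₀ • A) h1
      simpa only [smul_smul, mul_inv_cancel₀ hg0, one_smul] using this
    have := hkill
    rw [hG1, mul_smul_comm, mul_one, smul_eq_zero] at this
    exact sub_eq_zero.1 (this.resolve_left hg0)

end Algebra

/-! ## §2  A non-trivial idempotent in the centraliser makes it unbounded (valued field) -/

section Unbounded

variable {K : Type*} [Field K] [Valued K ℤᵐ⁰]

omit [Valued K ℤᵐ⁰] in
/-- `(a e + (1 − e))(b e + (1 − e)) = ab·e + (1 − e)` for an idempotent `e`. [folklore] -/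
theorem idempotent_pencil_mul {e : Matrix (Fin 2) (Fin 2) K} (he : e * e = e) (a b : K) :
    (a • e + (1 - e)) * (b • e + (1 - e)) = (a * b) • e + (1 - e) := by
  have hef : e * (1 - e) = 0 := by rw [mul_sub, mul_one, he, sub_self]
  have hfe : (1 - e) * e = 0 := by rw [sub_mul, one_mul, he, sub_self]
  have hff : (1 - e) * (1 - e) = 1 - e := by rw [mul_sub, mul_one, hfe, sub_zero]
  rw [add_mul, mul_add, mul_add, smul_mul_smul_comm, he, smul_mul_assoc, hef, smul_zero, add_zero, mul_smul_comm, hfe, smul_zero, zero_add, hff]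

/-- **IDEMPOTENT ⇒ UNBOUNDED CENTRALISER.**  For an idempotent `e ≠ 0, 1` commuting with `h` and a uniformizer `ϖ`: for every `N` some `y_n = ϖⁿ e + (1 − e) ∈ Z(h)`
(`y_n⁻¹ = ϖ⁻ⁿ e + (1 − e)`) has entries with `exp N < v((y_n)_{ij}) · v((y_n⁻¹)_{i′j′})`. [cite: HarishChandra1970, Part VI §8] -/
theorem exists_centralizer_unbounded_of_idempotent {ϖ : K} (hϖ : Valued.v ϖ = WithZero.exp (-1 : ℤ)) (h : GL (Fin 2) K)
    {e : Matrix (Fin 2) (Fin 2) K} (he : e * e = e) (hhe : (h : Matrix (Fin 2) (Fin 2) K) * e = e * (h : Matrix (Fin 2) (Fin 2) K)) (he0 : e ≠ 0) (he1 : e ≠ 1) (N : ℕ) :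
    ∃ y : GL (Fin 2) K, y * h = h * y ∧ ∃ i j i' j' : Fin 2,
      WithZero.exp (N : ℤ) < Valued.v ((y : Matrix (Fin 2) (Fin 2) K) i j) * Valued.v (((y⁻¹ : GL (Fin 2) K) : Matrix (Fin 2) (Fin 2) K) i' j') := by
  -- entries `e_{i′j′} ≠ 0` and `(1 − e)_{ij} ≠ 0`
  obtain ⟨i', j', hij'⟩ : ∃ i' j', e i' j' ≠ 0 := by
    by_contra hc; push Not at hc; exact he0 (Matrix.ext hc)
  obtain ⟨i, j, hij⟩ : ∃ i j, (1 - e) i j ≠ 0 := by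
    by_contra hc; push Not at hc; exact he1 (sub_eq_zero.1 (Matrix.ext hc)).symm
  obtain ⟨a, ha⟩ := exists_v_eq_exp hij'
  obtain ⟨b, hb⟩ := exists_v_eq_exp hij
  obtain ⟨c₁, hc₁⟩ := exists_v_le_exp ((1 - e) i' j')
  obtain ⟨c₂, hc₂⟩ := exists_v_le_exp (e i j)
  -- the exponent
  set n : ℕ := (N - a - b).toNat + (c₁ - a).toNat + (c₂ - b).toNat + 1 with hn
  have hn1 : (N : ℤ) < n + a + b := by have := Int.self_le_toNat (N - a - b); omega
  have hn2 : c₁ < (n : ℤ) + a := by have := Int.self_le_toNat (c₁ - a); omega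
  have hn3 : -(n : ℤ) + c₂ < b := by have := Int.self_le_toNat (c₂ - b); omega
  obtain ⟨hvc, hϖn⟩ := v_inv_pow_uniformizer hϖ n
  have hvϖn : Valued.v (ϖ ^ n) = WithZero.exp (-(n : ℤ)) := by
    rw [map_pow, hϖ, ← WithZero.exp_nsmul]; congr 1; simp
  -- the unit `y_n`
  have hmul1 : (ϖ ^ n • e + (1 - e)) * ((ϖ ^ n)⁻¹ • e + (1 - e)) = 1 := by rw [idempotent_pencil_mul he, mul_inv_cancel₀ hϖn, one_smul, add_sub_cancel]
  have hmul2 : ((ϖ ^ n)⁻¹ • e + (1 - e)) * (ϖ ^ n • e + (1 - e)) = 1 := by rw [idempotent_pencil_mul he, inv_mul_cancel₀ hϖn, one_smul, add_sub_cancel]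
  let y : GL (Fin 2) K := ⟨ϖ ^ n • e + (1 - e), (ϖ ^ n)⁻¹ • e + (1 - e), hmul1, hmul2⟩
  refine ⟨y, ?_, i, j, i', j', ?_⟩
  · -- `y h = h y` (`e` commutes with `h`)
    apply Units.ext
    show (ϖ ^ n • e + (1 - e)) * (h : Matrix (Fin 2) (Fin 2) K) = (h : Matrix (Fin 2) (Fin 2) K) * (ϖ ^ n • e + (1 - e))
    rw [add_mul, mul_add, smul_mul_assoc, mul_smul_comm, ← hhe, sub_mul, mul_sub, one_mul, mul_one, hhe]
  · -- `v((y_n)_{ij}) = v((1 − e)_{ij})`, `v((y_n⁻¹)_{i′j′}) = qⁿ·v(e_{i′j′})`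
    have hy : ((y : GL (Fin 2) K) : Matrix (Fin 2) (Fin 2) K) i j = ϖ ^ n * e i j + (1 - e) i j := by
      show (ϖ ^ n • e + (1 - e)) i j = _
      simp [Matrix.add_apply, Matrix.smul_apply]
    have hy' : (((y⁻¹ : GL (Fin 2) K)) : Matrix (Fin 2) (Fin 2) K) i' j' = (ϖ ^ n)⁻¹ * e i' j' + (1 - e) i' j' := by
      show ((ϖ ^ n)⁻¹ • e + (1 - e)) i' j' = _
      simp [Matrix.add_apply, Matrix.smul_apply]
    have h1 : Valued.v (ϖ ^ n * e i j + (1 - e) i j) = WithZero.exp b := by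
      rw [← hb]
      refine Valued.v.map_add_eq_of_lt_right ?_
      rw [map_mul, hvϖn, hb]
      calc WithZero.exp (-(n : ℤ)) * Valued.v (e i j) ≤ WithZero.exp (-(n : ℤ)) * WithZero.exp c₂ := mul_le_mul' le_rfl hc₂
        _ = WithZero.exp (-(n : ℤ) + c₂) := by rw [WithZero.exp_add]
        _ < WithZero.exp b := WithZero.exp_lt_exp.2 hn3
    have h2 : Valued.v ((ϖ ^ n)⁻¹ * e i' j' + (1 - e) i' j') = WithZero.exp ((n : ℤ) + a) := by
      have hlead : Valued.v ((ϖ ^ n)⁻¹ * e i' j') = WithZero.exp ((n : ℤ) + a) := by rw [map_mul, hvc, ha, WithZero.exp_add]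
      rw [← hlead]
      refine Valued.v.map_add_eq_of_lt_left ?_
      rw [hlead]
      exact lt_of_le_of_lt hc₁ (WithZero.exp_lt_exp.2 hn2)
    rw [hy, hy', h1, h2, ← WithZero.exp_add]
    exact WithZero.exp_lt_exp.2 (by omega)

end Unbounded

end Summit.HodgeConjecture.HodgeConjecture.Cruxes.H413.K2E3GL2SpectralIdempotentCentralizer

end
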